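import Mathlib
import HarnessLib
import Literature.NumberTheory.Transcendental.KZProductIdeal
import Literature.NumberTheory.Transcendental.KZSemiCanonicalReductionProofs
import Literature.NumberTheory.Transcendental.MZVSimplexRep

/-!
# Crux `ArrangementNormalForm` (stmt-KontsevichZagierPeriods-3915), line `janus-bands`: `stub_words`

Lettered order cells (each coordinate strictly between two bounds which are other coordinates or
rational constants, bounded domain, integrand `q · ∏ 1/(zᵢ − aᵢ)`) are `ℤ`-combinations of WORDS
`[Δ_k, q' · ∏ 1/(tᵢ − a'ᵢ)]` modulo `KZ.relations`: one dissection (rule 1a) into the *pattern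
cells* `cell g τ = Ψ g ⁻¹' {u | u ∘ τ ∈ Δ_k}` (`g` assigns to each coordinate a gap between
consecutive constants — those of the bounds and a rational box bound `±M` —, `Ψ g` rescales every
gap affinely onto `(0, 1)`, `τ` is the order pattern of the rescaled coordinates; the uncovered
set is a finite union of null hyperplanes; a pattern cell lies inside the order cell or misses it,
`mem_orderCell_iff`), then on each piece the affine change of variables `Ψ g` and a coordinate
permutation (rule 2) give a word (`piece_word`). No integrand is split.
Reference: M. Kontsevich, D. Zagier, *Periods* (2001), §1.2 rules (1a), (2).
-/

noncomputable section

open MeasureTheory Set MvPolynomial Literature.NumberTheory.Transcendental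
open Literature.ModelTheory.ExponentialFields

namespace Summit.KontsevichZagierPeriods.ArrangementNormalForm.JanusBands
variable {k : ℕ}

/-- A level set of a non-zero linear functional on `ℝᵏ` is Lebesgue-null. -/
theorem volume_setOf_linear_eq (ℓ : (Fin k → ℝ) →ₗ[ℝ] ℝ) {z₀ : Fin k → ℝ} (h0 : ℓ z₀ ≠ 0)
    (c : ℝ) : volume {z : Fin k → ℝ | ℓ z = c} = 0 := by
  have hker : LinearMap.ker ℓ ≠ ⊤ := fun htop =>
    h0 (LinearMap.mem_ker.mp (htop ▸ Submodule.mem_top : z₀ ∈ LinearMap.ker ℓ))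
  have hset : {z : Fin k → ℝ | ℓ z = c} =
      (fun z => z + (-(c / ℓ z₀)) • z₀) ⁻¹' (LinearMap.ker ℓ : Set (Fin k → ℝ)) := by
    ext z
    simp only [mem_setOf_eq, mem_preimage, SetLike.mem_coe, LinearMap.mem_ker, map_add,
      map_smul, smul_eq_mul, neg_mul, div_mul_cancel₀ _ h0]
    constructor <;> intro h <;> linarith
  rw [hset, measure_preimage_add_right]
  exact Measure.addHaar_submodule volume _ hker

/-- A simple letter `u ↦ 1 / (u i - b)` (junk value `0` at the pole) is semialgebraic. -/
theorem isSemialgebraicFunOn_inv_sub {S : Set (Fin k → ℝ)} (hS : IsSemialgebraic ℚ S)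
    (i : Fin k) (b : ℚ) : IsSemialgebraicFunOn ℚ S (fun u => 1 / (u i - (b : ℝ))) := by
  rw [isSemialgebraicFunOn_iff]
  let Y : MvPolynomial (Fin (k + 1)) ℚ := X (Fin.castSucc i) - C b
  convert hS.setOf_init_mem.inter
    ((isSemialgebraic_setOf_eval_eq_zero (R := ℝ) (Y * X (Fin.last k) - 1)).union
      ((isSemialgebraic_setOf_eval_eq_zero (R := ℝ) Y).inter
        (isSemialgebraic_setOf_eval_eq_zero (R := ℝ)
          (X (Fin.last k) : MvPolynomial (Fin (k + 1)) ℚ)))) using 1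
  ext z
  simp only [mem_setOf_eq, mem_inter_iff, mem_union, Y, map_sub, map_mul, map_one, aeval_X,
    aeval_C, eq_ratCast, Fin.init]
  refine and_congr_right fun _ => ?_
  rcases eq_or_ne (z (Fin.castSucc i) - (b : ℝ)) 0 with h | h
  · simp [h]
  · rw [eq_div_iff h, ← sub_eq_zero]; simp [h, mul_comm]

/-- A word integrand `u ↦ q · ∏ᵢ 1 / (u i - bᵢ)` is semialgebraic on any semialgebraic set. -/
theorem isSemialgebraicFunOn_word {S : Set (Fin k → ℝ)} (hS : IsSemialgebraic ℚ S) (q : ℚ)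
    (b : Fin k → ℚ) :
    IsSemialgebraicFunOn ℚ S (fun u => (q : ℝ) * ∏ i, 1 / (u i - (b i : ℝ))) := by
  have hp : ∀ T : Finset (Fin k),
      IsSemialgebraicFunOn ℚ S (fun u => ∏ i ∈ T, 1 / (u i - (b i : ℝ))) := by
    intro T
    induction T using Finset.induction_on with
    | empty => exact (isSemialgebraicFunOn_aeval hS 1).congr fun u _ => by simp
    | insert a T ha ih =>
      convert IsSemialgebraicFunOn.mul_holds (isSemialgebraicFunOn_inv_sub hS a (b a)) ih using 1
      ext u
      simp [Finset.prod_insert ha]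
  exact IsSemialgebraicFunOn.mul_holds
    ((isSemialgebraicFunOn_aeval hS (C q)).congr fun u _ => by simp) (hp Finset.univ)

/-- A tuple with distinct entries can be sorted into strictly decreasing order. -/
theorem exists_perm_strictAnti {u : Fin k → ℝ} (hu : Function.Injective u) :
    ∃ τ : Equiv.Perm (Fin k), StrictAnti (fun j => u (τ j)) := by
  have ha : Antitone (fun j => u (Tuple.sort (fun i => -u i) j)) := fun a b hab => by
    simpa only [Function.comp_apply, neg_le_neg_iff] using Tuple.monotone_sort (fun i => -u i) hab
  exact ⟨_, ha.strictAnti_of_injective (hu.comp (Equiv.injective _))⟩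

/-- The strictly decreasing rearrangement is unique. -/
theorem perm_eq_of_strictAnti {u : Fin k → ℝ} {σ τ : Equiv.Perm (Fin k)}
    (hσ : StrictAnti (fun j => u (σ j))) (hτ : StrictAnti (fun j => u (τ j))) : σ = τ := by
  have h : u ∘ σ = u ∘ τ := Tuple.unique_antitone hσ.antitone hτ.antitone
  have hu : Function.Injective u := hσ.injective.of_comp_right σ.surjective
  exact Equiv.ext fun j => hu (by simpa using congrFun h j)

/-- Two distinct gaps (consecutive pairs of a finite set `K` of constants) are separated. -/
theorem gaps_sep {K : Finset ℚ} {e e' : ℚ × ℚ}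
    (he : (e.1 ∈ K ∧ e.2 ∈ K) ∧ e.1 < e.2 ∧ ∀ c ∈ K, c ≤ e.1 ∨ e.2 ≤ c)
    (he' : (e'.1 ∈ K ∧ e'.2 ∈ K) ∧ e'.1 < e'.2 ∧ ∀ c ∈ K, c ≤ e'.1 ∨ e'.2 ≤ c) (hne : e ≠ e') :
    e.2 ≤ e'.1 ∨ e'.2 ≤ e.1 := by
  obtain ⟨⟨⟨h1, h2⟩, -, hc⟩, ⟨h1', h2'⟩, -, hc'⟩ := And.intro he he'
  rcases hc _ h1' with h | h; swap; · exact Or.inl h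
  rcases hc' _ h1 with h' | h'; swap; · exact Or.inr h'
  rcases hc _ h2' with h₃ | h₃; · exact Or.inr h₃
  rcases hc' _ h2 with h₄ | h₄; · exact Or.inl h₄
  exact (hne (Prod.ext (le_antisymm h' h) (le_antisymm h₃ h₄))).elim

/-- A point which is not a constant and lies strictly between two constants lies in a gap. -/
theorem exists_gap {K : Finset ℚ} {x : ℝ} (hlo : ∃ c ∈ K, (c : ℝ) < x) (hhi : ∃ c ∈ K, x < (c : ℝ))
    (hne : ∀ c ∈ K, (c : ℝ) ≠ x) : ∃ e : ℚ × ℚ, ((e.1 ∈ K ∧ e.2 ∈ K) ∧ e.1 < e.2 ∧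
      ∀ c ∈ K, c ≤ e.1 ∨ e.2 ≤ c) ∧ (e.1 : ℝ) < x ∧ x < (e.2 : ℝ) := by
  classical
  set A := K.filter (fun c : ℚ => (c : ℝ) < x)
  set B := K.filter (fun c : ℚ => x < (c : ℝ))
  have hA : A.Nonempty := let ⟨c, hc, h⟩ := hlo; ⟨c, Finset.mem_filter.mpr ⟨hc, h⟩⟩
  have hB : B.Nonempty := let ⟨c, hc, h⟩ := hhi; ⟨c, Finset.mem_filter.mpr ⟨hc, h⟩⟩
  have ha := Finset.mem_filter.mp (A.max'_mem hA)
  have hb := Finset.mem_filter.mp (B.min'_mem hB)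
  refine ⟨(A.max' hA, B.min' hB), ⟨⟨ha.1, hb.1⟩, ?_, fun c hc => ?_⟩, ha.2, hb.2⟩
  · exact_mod_cast ha.2.trans hb.2
  · rcases lt_or_gt_of_ne (hne c hc) with h | h
    · exact Or.inl (A.le_max' c (Finset.mem_filter.mpr ⟨hc, h⟩))
    · exact Or.inr (B.min'_le c (Finset.mem_filter.mpr ⟨hc, h⟩))

section Pattern

/-! ### Pattern cells (`Ψ g z i = (z i − (g i).1) / ((g i).2 − (g i).1)` rescales the gaps,
`cell g τ = Ψ g ⁻¹' {u | u ∘ τ ∈ Δ_k}`: hypotheses with defining equations, fed `rfl` at the end) -/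

variable {Ψ : (Fin k → ℚ × ℚ) → (Fin k → ℝ) → Fin k → ℝ}
  (hΨ : ∀ g z i, Ψ g z i = (z i - ((g i).1 : ℝ)) / (((g i).2 : ℝ) - ((g i).1 : ℝ)))
include hΨ

/-- `Ψ g` is a polynomial map of degree one. -/
theorem psi_eq_aeval (g : Fin k → ℚ × ℚ) : Ψ g = fun z i =>
    aeval z (C ((g i).2 - (g i).1)⁻¹ * (X i - C (g i).1) : MvPolynomial (Fin k) ℚ) :=
  funext fun z => funext fun i => by simp [hΨ, eq_ratCast, div_eq_inv_mul]

/-- Ties of two rescaled coordinates form a null hyperplane. -/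
theorem volume_tie {g : Fin k → ℚ × ℚ} (hg : ∀ i, (g i).1 < (g i).2) {i j : Fin k}
    (hij : i ≠ j) : volume {z : Fin k → ℝ | Ψ g z i = Ψ g z j} = 0 := by
  have hδ : ∀ i, (0 : ℝ) < (g i).2 - (g i).1 := fun i => sub_pos.mpr (by exact_mod_cast hg i)
  let ℓ : (Fin k → ℝ) →ₗ[ℝ] ℝ := (((g i).2 : ℝ) - (g i).1)⁻¹ • LinearMap.proj i -
    (((g j).2 : ℝ) - (g j).1)⁻¹ • LinearMap.proj j
  refine measure_mono_null (fun z (hz : Ψ g z i = Ψ g z j) => ?_)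
    (volume_setOf_linear_eq ℓ (z₀ := Pi.single i 1) (by simp [ℓ, hij.symm, (hδ i).ne'])
      ((((g i).2 : ℝ) - (g i).1)⁻¹ * (g i).1 - (((g j).2 : ℝ) - (g j).1)⁻¹ * (g j).1))
  change ℓ z = _
  simp only [hΨ, div_eq_inv_mul, mul_sub] at hz
  simp only [ℓ, LinearMap.sub_apply, LinearMap.smul_apply, LinearMap.proj_apply, smul_eq_mul]
  linarith

variable {cell : (Fin k → ℚ × ℚ) → Equiv.Perm (Fin k) → Set (Fin k → ℝ)}
  (hcell : ∀ g τ, cell g τ = Ψ g ⁻¹' ((fun u j => u (τ j)) ⁻¹' KZ.openOrderedSimplex k))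
include hcell

/-- Pattern cells are semialgebraic. -/
theorem isSemialgebraic_cell (g : Fin k → ℚ × ℚ) (τ : Equiv.Perm (Fin k)) :
    IsSemialgebraic ℚ (cell g τ) := by
  rw [hcell, psi_eq_aeval hΨ g]
  exact ((KZ.isSemialgebraic_openOrderedSimplex k).preimage_comp τ).preimage_aeval _

/-- Membership in a pattern cell: box conditions and the order pattern. -/
theorem mem_cell_iff {g : Fin k → ℚ × ℚ} (hg : ∀ i, (g i).1 < (g i).2) {τ : Equiv.Perm (Fin k)}
    {z : Fin k → ℝ} : z ∈ cell g τ ↔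
      (∀ i, ((g i).1 : ℝ) < z i ∧ z i < (g i).2) ∧ StrictAnti (fun j => Ψ g z (τ j)) := by
  have hδ : ∀ i, (0 : ℝ) < (g i).2 - (g i).1 := fun i => sub_pos.mpr (by exact_mod_cast hg i)
  simp only [hcell, KZ.openOrderedSimplex, mem_preimage, mem_setOf_eq, ← and_assoc, ← forall_and]
  refine and_congr_left fun _ => ?_
  rw [τ.forall_congr_right (q := fun i => 0 < Ψ g z i ∧ Ψ g z i < 1)]
  refine forall_congr' fun i => ?_
  simp only [hΨ, div_pos_iff_of_pos_right (hδ i), div_lt_one (hδ i), sub_pos, sub_lt_sub_iff_right]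

/-- **One piece is one word.** A representation `[cell g τ, q · ∏ 1/(zᵢ − aᵢ)]` is congruent to a
word (an element of `W`): rescale the gaps onto `(0, 1)` by `Ψ g` (rule 2), permute (rule 2). -/
theorem piece_word {W : Set KZ.FormalRep} (hW : ∀ (b : Fin k → ℚ) (q : ℚ) (s : KZ.IntegralRep k),
      s.domain = {t | (∀ i, 0 < t i) ∧ (∀ i, t i < 1) ∧ StrictAnti t} →
      EqOn s.integrand (fun t => (q : ℝ) * ∏ i, 1 / (t i - (b i : ℝ))) s.domain → KZ.of s ∈ W)
    (r : KZ.IntegralRep k) (q : ℚ) (a : Fin k → ℚ)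
    (hint : EqOn r.integrand (fun z => (q : ℝ) * ∏ i, 1 / (z i - (a i : ℝ))) r.domain)
    {g : Fin k → ℚ × ℚ} (hg : ∀ i, (g i).1 < (g i).2) (τ : Equiv.Perm (Fin k))
    (hr : r.domain = cell g τ) : ∃ y ∈ W, KZ.of r - y ∈ KZ.relations := by
  set α : Fin k → ℝ := fun i => ((g i).1 : ℝ) with hα
  set δ : Fin k → ℝ := fun i => ((g i).2 : ℝ) - ((g i).1 : ℝ) with hδ_def
  have hδ : ∀ i, 0 < δ i := fun i => sub_pos.mpr (by exact_mod_cast hg i)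
  set Δτ : Set (Fin k → ℝ) := (fun (u : Fin k → ℝ) j => u (τ j)) ⁻¹' KZ.openOrderedSimplex k
  let D : Matrix (Fin k) (Fin k) ℝ := Matrix.diagonal fun i => (δ i)⁻¹
  let L : (Fin k → ℝ) →L[ℝ] (Fin k → ℝ) := LinearMap.toContinuousLinearMap (Matrix.toLin' D)
  have hdet : |L.det| = ∏ i, (δ i)⁻¹ := by
    rw [show L.det = ∏ i, (δ i)⁻¹ from (LinearMap.det_toLin' D).trans (Matrix.det_diagonal)]
    exact abs_of_pos (Finset.prod_pos fun i _ => inv_pos.mpr (hδ i))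
  have hL : Ψ g = fun z => L z + fun i => -(α i / δ i) := by
    ext z i
    simp [hΨ, L, D, Matrix.mulVec_diagonal, hα, hδ_def, div_eq_inv_mul]
    ring
  have hderiv : ∀ z ∈ cell g τ, HasFDerivWithinAt (Ψ g) L (cell g τ) z := fun z _ => by
    rw [hL]
    exact (L.hasFDerivAt.add_const _).hasFDerivWithinAt
  have hinv : ∀ u, Ψ g (fun i => α i + δ i * u i) = u := fun u => funext fun i => by
    simp only [hΨ, hα, hδ_def]
    rw [add_sub_cancel_left, mul_div_cancel_left₀ _ (hδ i).ne']
  have hinj : InjOn (Ψ g) (cell g τ) := fun z _ z' _ h => funext fun i => by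
    have := congrFun h i
    simp only [hΨ] at this
    rwa [div_left_inj' (hδ i).ne', sub_left_inj] at this
  have himg : Ψ g '' cell g τ = Δτ := by
    rw [hcell]
    exact image_preimage_eq _ fun u => ⟨_, hinv u⟩
  have hsa : IsSemialgebraicMapOn ℚ (cell g τ) (Ψ g) :=
    (isSemialgebraicMapOn_aeval (isSemialgebraic_cell hΨ hcell g τ) _).congr
      fun z _ => (congrFun (psi_eq_aeval hΨ g) z).symm
  set b : Fin k → ℚ := fun i => (a i - (g i).1) / ((g i).2 - (g i).1) with hb_def
  set G : (Fin k → ℝ) → ℝ := fun u => (q : ℝ) * ∏ i, 1 / (u i - (b i : ℝ)) with hG_def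
  have hId : ∀ z, (q : ℝ) * ∏ i, 1 / (z i - (a i : ℝ)) = G (Ψ g z) * |L.det| := fun z => by
    rw [hdet, hG_def, mul_assoc, ← Finset.prod_mul_distrib]
    congr 1
    refine Finset.prod_congr rfl fun i _ => ?_
    have hb : ((b i : ℚ) : ℝ) = ((a i : ℝ) - α i) / δ i := by
      simp only [hb_def, hα, hδ_def]; push_cast; rfl
    simp only [hb, hΨ]
    rw [← sub_div, sub_sub_sub_cancel_right, one_div_div, div_mul_eq_mul_div,
      mul_inv_cancel₀ (hδ i).ne']
  have hΔ : IsSemialgebraic ℚ Δτ := (KZ.isSemialgebraic_openOrderedSimplex _).preimage_comp τ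
  have hmeas : MeasurableSet (cell g τ) :=
    IsSemialgebraic.measurableSet_holds (isSemialgebraic_cell hΨ hcell g τ)
  have hGint : IntegrableOn G Δτ := by
    rw [← himg, integrableOn_image_iff_integrableOn_abs_det_fderiv_smul volume hmeas hderiv hinj]
    refine ((hr ▸ r.integrableOn).congr_fun (fun z hz => ?_) hmeas)
    rw [smul_eq_mul, mul_comm]
    exact (hint (hr ▸ hz)).trans (hId z)
  let r'' : KZ.IntegralRep k := ⟨Δτ, G, hΔ, isSemialgebraicFunOn_word hΔ q b, hGint⟩
  have hcov : KZ.of r - KZ.of r'' ∈ KZ.relations :=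
    KZ.changeOfVariablesRel_subset_relations ⟨k, r, r'', Ψ g, fun _ => L, hr ▸ hsa, hr ▸ hderiv,
      hr ▸ hinj, by rw [hr]; exact himg.symm, fun z hz => (hint hz).trans (hId z), rfl⟩
  refine ⟨_, hW (fun j => b (τ j)) q (r''.reindex τ.symm) ?_ ?_, ?_⟩
  · ext t
    simp [KZ.IntegralRep.reindex_domain, r'', Δτ, KZ.openOrderedSimplex]
  · intro t _
    simp only [KZ.IntegralRep.reindex_integrand, r'', hG_def]
    congr 1
    exact (Equiv.prod_comp τ (fun i => 1 / (t (τ.symm i) - (b i : ℝ)))).symm.trans (by simp)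
  · have := KZ.relations.add_mem hcov (KZ.of_sub_of_reindex_mem_relations r'' τ.symm)
    rwa [sub_add_sub_cancel] at this

/-- **Dichotomy.** On a pattern cell (gaps from `K`) every defining comparison of an order cell
with constants in `K` is decided (`hkc`: with a constant; `hcc`: between two coordinates). -/
theorem mem_orderCell_iff {K : Finset ℚ} {g : Fin k → ℚ × ℚ} (hgK : ∀ i,
      ((g i).1 ∈ K ∧ (g i).2 ∈ K) ∧ (g i).1 < (g i).2 ∧ ∀ c ∈ K, c ≤ (g i).1 ∨ (g i).2 ≤ c)
    {τ : Equiv.Perm (Fin k)} {lo hi : Fin k → Fin k ⊕ ℚ} (hlo : ∀ i c, lo i = Sum.inr c → c ∈ K)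
    (hhi : ∀ i c, hi i = Sum.inr c → c ∈ K) {z z' : Fin k → ℝ} (hz : z ∈ cell g τ)
    (hz' : z' ∈ cell g τ) :
    (∀ i, Sum.elim z (fun c => (c : ℝ)) (lo i) < z i ∧ z i < Sum.elim z (fun c => (c : ℝ)) (hi i)) ↔
      ∀ i, Sum.elim z' (fun c => (c : ℝ)) (lo i) < z' i ∧
        z' i < Sum.elim z' (fun c => (c : ℝ)) (hi i) := by
  have hg : ∀ i, (g i).1 < (g i).2 := fun i => (hgK i).2.1
  obtain ⟨⟨hb, hs⟩, hb', hs'⟩ :=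
    And.intro ((mem_cell_iff hΨ hcell hg).mp hz) ((mem_cell_iff hΨ hcell hg).mp hz')
  have hkc : ∀ i c, c ∈ K → ((c : ℝ) < z i ↔ (c : ℝ) < z' i) ∧ (z i < c ↔ z' i < c) := by
    intro i c hc
    obtain ⟨⟨h1, h2⟩, h1', h2'⟩ := And.intro (hb i) (hb' i)
    rcases (hgK i).2.2 c hc with h | h
    · have h' : (c : ℝ) ≤ (g i).1 := by exact_mod_cast h
      exact ⟨iff_of_true (by linarith) (by linarith), iff_of_false (by linarith) (by linarith)⟩
    · have h' : ((g i).2 : ℝ) ≤ c := by exact_mod_cast h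
      exact ⟨iff_of_false (by linarith) (by linarith), iff_of_true (by linarith) (by linarith)⟩
  have hcc : ∀ i j, z i < z j ↔ z' i < z' j := by
    intro i j
    by_cases hij : g i = g j
    · have hδ : (0 : ℝ) < (g j).2 - (g j).1 := sub_pos.mpr (by exact_mod_cast hg j)
      have key : ∀ w : Fin k → ℝ, StrictAnti (fun l => Ψ g w (τ l)) →
          (w i < w j ↔ τ.symm j < τ.symm i) := fun w hw => by
        rw [← hw.lt_iff_gt]
        simp only [Equiv.apply_symm_apply, hΨ, hij]
        rw [div_lt_div_iff_of_pos_right hδ, sub_lt_sub_iff_right]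
      rw [key z hs, key z' hs']
    · rcases gaps_sep (hgK i) (hgK j) hij with h | h
      · have h' : ((g i).2 : ℝ) ≤ (g j).1 := by exact_mod_cast h
        exact iff_of_true (((hb i).2.trans_le h').trans (hb j).1)
          (((hb' i).2.trans_le h').trans (hb' j).1)
      · have h' : ((g j).2 : ℝ) ≤ (g i).1 := by exact_mod_cast h
        exact iff_of_false (((hb j).2.trans_le h').trans (hb i).1).asymm
          (((hb' j).2.trans_le h').trans (hb' i).1).asymm
  refine forall_congr' fun i => and_congr ?_ ?_
  · rcases hl : lo i with j | c
    · exact hcc j i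
    · exact (hkc i c (hlo i c hl)).1
  · rcases hh : hi i with j | c
    · exact hcc i j
    · exact (hkc i c (hhi i c hh)).2

/-- **Lettered order cells are `ℤ`-combinations of words** (elements of `W`): dissect into pattern
cells (rule 1a, `KZ.of_sub_sum_of_mem_relations`; the uncovered set is null), apply `piece_word`. -/
theorem orderCell_words {W : Set KZ.FormalRep} (hW : ∀ (b : Fin k → ℚ) (q : ℚ)
      (s : KZ.IntegralRep k), s.domain = {t | (∀ i, 0 < t i) ∧ (∀ i, t i < 1) ∧ StrictAnti t} →
      EqOn s.integrand (fun t => (q : ℝ) * ∏ i, 1 / (t i - (b i : ℝ))) s.domain → KZ.of s ∈ W)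
    (s : KZ.IntegralRep k) (q : ℚ) (a : Fin k → ℚ) (lo hi : Fin k → Fin k ⊕ ℚ)
    (hbd : Bornology.IsBounded s.domain)
    (hdom : s.domain = {z | ∀ i, Sum.elim z (fun c => (c : ℝ)) (lo i) < z i ∧
      z i < Sum.elim z (fun c => (c : ℝ)) (hi i)})
    (hint : EqOn s.integrand (fun z => (q : ℝ) * ∏ i, 1 / (z i - (a i : ℝ))) s.domain) :
    ∃ c ∈ AddSubgroup.closure W, KZ.of s - c ∈ KZ.relations := by
  obtain ⟨ρ, hρ⟩ := hbd.subset_closedBall (0 : Fin k → ℝ)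
  obtain ⟨M, hM⟩ := exists_rat_gt ρ
  have hzM : ∀ z ∈ s.domain, ∀ i, -(M : ℝ) < z i ∧ z i < M := fun z hz i => by
    have h := (norm_le_pi_norm z i).trans (mem_closedBall_zero_iff.mp (hρ hz))
    rw [Real.norm_eq_abs, abs_le] at h
    constructor <;> linarith [h.1, h.2]
  let K : Finset ℚ := insert M (insert (-M) (Finset.univ.image lo ∪ Finset.univ.image hi).toRight)
  have hK : ∀ i c, (lo i = Sum.inr c → c ∈ K) ∧ (hi i = Sum.inr c → c ∈ K) := fun i c => by
    constructor <;> intro h <;> simp only [K, Finset.mem_insert, Finset.mem_toRight,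
      Finset.mem_union, Finset.mem_image, Finset.mem_univ, true_and] <;>
      first | exact .inr (.inr (.inl ⟨i, h⟩)) | exact .inr (.inr (.inr ⟨i, h⟩))
  let I : Finset (Fin k → ℚ × ℚ) :=
    Fintype.piFinset fun _ => (K ×ˢ K).filter fun e => e.1 < e.2 ∧ ∀ c ∈ K, c ≤ e.1 ∨ e.2 ≤ c
  have hI : ∀ g ∈ I, ∀ i, (((g i).1 ∈ K ∧ (g i).2 ∈ K) ∧ (g i).1 < (g i).2 ∧
      ∀ c ∈ K, c ≤ (g i).1 ∨ (g i).2 ≤ c) := fun g hg i => by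
    simpa using Fintype.mem_piFinset.mp hg i
  classical
  let S : Finset ((Fin k → ℚ × ℚ) × Equiv.Perm (Fin k)) :=
    (I ×ˢ Finset.univ).filter fun p => cell p.1 p.2 ⊆ s.domain
  have hS : ∀ p ∈ S, p.1 ∈ I ∧ cell p.1 p.2 ⊆ s.domain := fun p hp => by
    simpa [S, Finset.mem_filter] using hp
  let R : (Fin k → ℚ × ℚ) × Equiv.Perm (Fin k) → KZ.IntegralRep k := fun p =>
    s.restrict (cell p.1 p.2 ∩ s.domain)
      ((isSemialgebraic_cell hΨ hcell p.1 p.2).inter s.isSemialgebraic_domain) inter_subset_right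
  let P : Finset (Fin k × Fin k) := Finset.univ.filter fun p => p.1 ≠ p.2
  let N₁ : Set (Fin k → ℝ) := ⋃ i : Fin k, ⋃ c ∈ K, {z | z i = (c : ℝ)}
  let N₂ : Set (Fin k → ℝ) := ⋃ g ∈ I, ⋃ p ∈ P, {z | Ψ g z p.1 = Ψ g z p.2}
  have hN : volume (N₁ ∪ N₂) = 0 := by
    refine measure_union_null (measure_iUnion_null fun i => ?_)
      ((measure_biUnion_null_iff I.countable_toSet).mpr fun g hg =>
        (measure_biUnion_null_iff P.countable_toSet).mpr fun p hp =>
          volume_tie hΨ (fun i => (hI g hg i).2.1) (Finset.mem_filter.mp hp).2)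
    exact (measure_biUnion_null_iff K.countable_toSet).mpr fun c _ =>
      volume_setOf_linear_eq (LinearMap.proj i) (z₀ := fun _ => 1) (by simp) c
  have hcov : s.domain \ (⋃ p ∈ S, (R p).domain) ⊆ N₁ ∪ N₂ := by
    rintro z ⟨hzD, hzU⟩
    by_contra hzN
    have hgap := fun i => exists_gap (K := K) (x := z i)
      ⟨-M, by simp [K], by push_cast; exact (hzM z hzD i).1⟩ ⟨M, by simp [K], (hzM z hzD i).2⟩
      fun c hc h => hzN (Or.inl (mem_iUnion.mpr ⟨i, mem_iUnion₂.mpr ⟨c, hc, h.symm⟩⟩))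
    choose g hgK hgz using hgap
    have hgI : g ∈ I := Fintype.mem_piFinset.mpr fun i => by simpa using hgK i
    have hinjz : Function.Injective (Ψ g z) := fun i j h => by_contra fun hij =>
      hzN (Or.inr (mem_iUnion₂.mpr ⟨g, hgI, mem_iUnion₂.mpr
        ⟨(i, j), Finset.mem_filter.mpr ⟨Finset.mem_univ _, hij⟩, h⟩⟩))
    obtain ⟨τ, hτ⟩ := exists_perm_strictAnti hinjz
    have hzc : z ∈ cell g τ := (mem_cell_iff hΨ hcell fun i => (hgK i).2.1).mpr ⟨hgz, hτ⟩
    have hsub : cell g τ ⊆ s.domain := fun z' hz' => by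
      rw [hdom] at hzD ⊢
      exact (mem_orderCell_iff hΨ hcell hgK (fun i c => (hK i c).1) (fun i c => (hK i c).2)
        hzc hz').mp hzD
    exact hzU (mem_iUnion₂.mpr ⟨(g, τ), Finset.mem_filter.mpr ⟨Finset.mem_product.mpr
      ⟨hgI, Finset.mem_univ _⟩, hsub⟩, (⟨hzc, hzD⟩ : z ∈ cell g τ ∩ s.domain)⟩)
  have hdisj : (S : Set ((Fin k → ℚ × ℚ) × Equiv.Perm (Fin k))).Pairwise
      fun p p' => volume ((R p).domain ∩ (R p').domain) = 0 := by
    intro p hp p' hp' hne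
    convert measure_empty (μ := (volume : Measure (Fin k → ℝ)))
    change (cell p.1 p.2 ∩ s.domain) ∩ (cell p'.1 p'.2 ∩ s.domain) = ∅
    refine eq_empty_of_forall_notMem fun z ⟨⟨hz, _⟩, hz', _⟩ => hne ?_
    obtain ⟨hb, hs⟩ := (mem_cell_iff hΨ hcell fun i => (hI _ (hS p hp).1 i).2.1).mp hz
    obtain ⟨hb', hs'⟩ := (mem_cell_iff hΨ hcell fun i => (hI _ (hS p' hp').1 i).2.1).mp hz'
    have hgeq : p.1 = p'.1 := by
      refine funext fun i => by_contra fun hne_i => ?_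
      rcases gaps_sep (hI _ (hS p hp).1 i) (hI _ (hS p' hp').1 i) hne_i with h | h
      · exact (not_lt.mpr h) (by exact_mod_cast (hb' i).1.trans (hb i).2)
      · exact (not_lt.mpr h) (by exact_mod_cast (hb i).1.trans (hb' i).2)
    exact Prod.ext hgeq (perm_eq_of_strictAnti hs (by rw [hgeq]; exact hs'))
  have hdiss : KZ.of s - ∑ p ∈ S, KZ.of (R p) ∈ KZ.relations := by
    refine KZ.of_sub_sum_of_mem_relations S s R (fun p _ => ?_) (fun p _ x _ => rfl)
      (measure_mono_null hcov hN) hdisj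
    change volume ((cell p.1 p.2 ∩ s.domain) \ s.domain) = 0
    rw [sdiff_eq_empty.mpr inter_subset_right, measure_empty]
  have hB : ∀ p, ∃ y, p ∈ S → y ∈ W ∧ KZ.of (R p) - y ∈ KZ.relations := fun p => by
    by_cases hp : p ∈ S
    · obtain ⟨y, hy, hrel⟩ := piece_word hΨ hcell hW (R p) q a (hint.mono inter_subset_right)
        (fun i => (hI _ (hS p hp).1 i).2.1) p.2 (inter_eq_left.mpr (hS p hp).2)
      exact ⟨y, fun _ => ⟨hy, hrel⟩⟩
    · exact ⟨0, fun h => (hp h).elim⟩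
  choose Y hY using hB
  refine ⟨∑ p ∈ S, Y p,
    AddSubgroup.sum_mem _ fun p hp => AddSubgroup.subset_closure (hY p hp).1, ?_⟩
  have := KZ.relations.add_mem hdiss
    (KZ.sum_sub_sum_mem_relations S (fun p => KZ.of (R p)) Y fun p hp => (hY p hp).2)
  rwa [sub_add_sub_cancel] at this

end Pattern

/-- **stub_words.** Lettered order cells are `ℤ`-combinations of words modulo `KZ.relations`
(`orderCell_words`: dissect into pattern cells relative to the gaps of the constant bounds, rescale
each gap affinely onto `(0,1)`, permute coordinates into decreasing order; nothing is split). -/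
theorem stub_words (Jw : Set KZ.FormalRep) (hJw : Jw = {w : KZ.FormalRep | ∃ (k : ℕ) (s : KZ.IntegralRep k) (q : ℚ) (a : Fin k → ℚ) (lo hi : Fin k → Fin k ⊕ ℚ), Bornology.IsBounded s.domain ∧ s.domain = {z | ∀ i, Sum.elim z (fun c => (c : ℝ)) (lo i) < z i ∧ z i < Sum.elim z (fun c => (c : ℝ)) (hi i)} ∧ EqOn s.integrand (fun z => (q : ℝ) * ∏ i, 1 / (z i - (a i : ℝ))) s.domain ∧ w = KZ.of s}) : ∀ x ∈ Jw, ∃ c ∈ AddSubgroup.closure {y : KZ.FormalRep | ∃ (w : ℕ) (a : Fin w → ℚ) (q : ℚ) (s : KZ.IntegralRep w), s.domain = {t | (∀ i, 0 < t i) ∧ (∀ i, t i < 1) ∧ StrictAnti t} ∧ Set.EqOn s.integrand (fun t => (q : ℝ) * ∏ i, 1 / (t i - (a i : ℝ))) s.domain ∧ y = KZ.of s}, x - c ∈ KZ.relations := by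
  intro x hx
  rw [hJw] at hx
  obtain ⟨k, s, q, a, lo, hi, hbd, hdom, hint, rfl⟩ := hx
  refine orderCell_words (fun _ _ _ => rfl) (fun _ _ => rfl) ?_ s q a lo hi hbd hdom hint
  exact fun b q' s' h1 h2 => ⟨k, b, q', s', h1, h2, rfl⟩

end Summit.KontsevichZagierPeriods.ArrangementNormalForm.JanusBands

end
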